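import Summits.Ventures.PercRepro.RankLevelSetUpClassCutDecomp

/-! # RankLevelSetUpClassCut — (↑) AT LEVEL `4` ALONG A SERIES CLASS OF SIZE `≥ 3` WITHOUT THE CLAIM: THE CLASS-CUT
REDUCTION (night-1 g39; dossier §51; on `RankLevelSetUpClassCutDecomp`)

The families `A_4 = upFull`, `Ā_5 = avoidFull`, `g_3 = throughHat`, `ḡ_3, ḡ_4 = avoidHat` of `(N, p, b)` live on
`E' = E ∖ cl {p}` and do not depend on the size `q` of the class `P = cl {p}` (**`upFull_delete_parallel`** and its
three siblings, via `Coindep.delete_spanning_iff`). Cutting the class down to two elements,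
`N''' = N ＼ (P ∖ {p, p'})`, gives a matroid with `n − q + 2 < n` elements whose level-`4` (↑) is supplied by the
strong induction on `#E` that already runs in `upAt_of_nullity_four_of_claim`. The exact decompositions along the
class (`through_four_le` / `through_four_ge`, `avoid_five_ge` / `avoid_five_le`) then give, for `#E' ≥ 8`,
`T_4(N) = T_4(N''') + (q − 2) · g_3 ≤ V_5(N''') + (q − 2) · g_3 ≤ Ā_5 + 2 ḡ_4 + ḡ_3 + (q − 2) g_3 ≤ Ā_5 + q ḡ_4 + ḡ_3
≤ V_5(N)` with `g_3 ≤ ḡ_4` (`throughHat_three_le_avoidHat_four`); for `#E' ≤ 7` the claim holds outright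
(`upFull_four_eq_empty_of_le_six`, `upFull_four_le_avoidHat_three_of_seven`) and `upAt_four_of_seriesClass`
applies. Hence **`upAt_four_of_seriesClass_of_ih`**: (↑) at level `4` at every `b` outside a series class of size
`≥ 3`, from (↑) at level `4` on the matroids with fewer elements — `UpSeriesClaim` is not needed. Every declaration
has a docstring; imports: the cell's own modules and Mathlib only. Axioms: standard. -/

namespace PercRepro

open Set Matroid

variable {α : Type}

variable (N : Matroid α) [N.Finite]

/-! ## Deleting parallel copies of `p` -/

omit [N.Finite] in
/-- A set of parallel copies of `p` not containing `p` is coindependent: `insert p (E ∖ cl {p})` spans. -/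
lemma coindep_of_subset_closure_of_notMem {p : α} (hp : p ∈ N.E) {D : Set α} (hD : D ⊆ N.closure {p})
    (hpD : p ∉ D) : N.Coindep D := by
  have hDE : D ⊆ N.E := hD.trans (N.closure_subset_ground _)
  rw [Matroid.coindep_iff_compl_spanning hDE]
  have hsp : N.Spanning (insert p (N.E \ N.closure {p})) := by
    refine spanning_insert_of_spanning_union N hp (subset_refl (N.closure {p})) Set.sdiff_subset ?_
    rw [Set.sdiff_union_of_subset (N.closure_subset_ground _)]
    exact N.ground_spanning
  refine hsp.superset ?_ Set.sdiff_subset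
  intro x hx
  rcases hx with rfl | hx
  · exact ⟨hp, hpD⟩
  · exact ⟨hx.1, fun h => hx.2 (hD h)⟩

omit [N.Finite] in
/-- Spanning is unchanged by deleting a coindependent set disjoint from the set in question. -/
lemma delete_spanning_iff_of_disjoint {D X : Set α} (hD : N.Coindep D) (hXD : Disjoint X D) :
    (N.delete D).Spanning X ↔ N.Spanning X := by
  rw [hD.delete_spanning_iff]
  exact ⟨fun h => h.1, fun h => ⟨h, hXD⟩⟩

omit [N.Finite] in
/-- **`E ∖ cl {p}` is unchanged by deleting parallel copies of `p`.** -/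
lemma delete_ground_sdiff_closure {p : α} {D : Set α} (hD : D ⊆ N.closure {p}) (hpD : p ∉ D) :
    (N.delete D).E \ (N.delete D).closure {p} = N.E \ N.closure {p} := by
  rw [Matroid.delete_ground, Matroid.delete_closure_eq_of_disjoint N (Set.disjoint_singleton_left.mpr hpD)]
  ext x
  simp only [Set.mem_sdiff, not_and, not_not]
  constructor
  · rintro ⟨⟨hxE, hxD⟩, h⟩
    exact ⟨hxE, fun hxP => hxD (h hxP)⟩
  · rintro ⟨hxE, hxP⟩
    exact ⟨⟨hxE, fun hxD => hxP (hD hxD)⟩, fun hxP' => absurd hxP' hxP⟩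

omit [N.Finite] in
/-- A subset of `E ∖ cl {p}` is disjoint from a set of parallel copies of `p`. -/
lemma disjoint_of_subset_sdiff_closure {p : α} {D X : Set α} (hD : D ⊆ N.closure {p})
    (hX : X ⊆ N.E \ N.closure {p}) : Disjoint X D := by
  rw [Set.disjoint_left]
  intro x hxX hxD
  exact (hX hxX).2 (hD hxD)

omit [N.Finite] in
/-- `insert p X` is disjoint from a set of parallel copies of `p` not containing `p`, for `X ⊆ E ∖ cl {p}`. -/
lemma disjoint_insert_of_subset_sdiff_closure {p : α} {D X : Set α} (hD : D ⊆ N.closure {p}) (hpD : p ∉ D)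
    (hX : X ⊆ N.E \ N.closure {p}) : Disjoint (insert p X) D := by
  rw [Set.disjoint_left]
  intro x hx hxD
  rcases hx with rfl | hx
  · exact hpD hxD
  · exact (hX hx).2 (hD hxD)

omit [N.Finite] in
/-- **`A_4` is unchanged by deleting parallel copies of `p`.** -/
lemma upFull_delete_parallel {p : α} (hp : p ∈ N.E) {D : Set α} (hD : D ⊆ N.closure {p}) (hpD : p ∉ D) (b : α)
    (k : ℕ) : upFull (N.delete D) p b k = upFull N p b k := by
  have hco := coindep_of_subset_closure_of_notMem N hp hD hpD
  have hE' := delete_ground_sdiff_closure N hD hpD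
  ext W
  simp only [upFull, Set.mem_setOf_eq, hE']
  constructor
  · rintro ⟨h1, h2, h3, h4, h5⟩
    refine ⟨h1, h2, h3, ?_, ?_⟩
    · exact (delete_spanning_iff_of_disjoint N hco (disjoint_of_subset_sdiff_closure N hD h1)).mp h4
    · exact (delete_spanning_iff_of_disjoint N hco
        (disjoint_insert_of_subset_sdiff_closure N hD hpD Set.sdiff_subset)).mp h5
  · rintro ⟨h1, h2, h3, h4, h5⟩
    refine ⟨h1, h2, h3, ?_, ?_⟩
    · exact (delete_spanning_iff_of_disjoint N hco (disjoint_of_subset_sdiff_closure N hD h1)).mpr h4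
    · exact (delete_spanning_iff_of_disjoint N hco
        (disjoint_insert_of_subset_sdiff_closure N hD hpD Set.sdiff_subset)).mpr h5

omit [N.Finite] in
/-- **`Ā_k` is unchanged by deleting parallel copies of `p`.** -/
lemma avoidFull_delete_parallel {p : α} (hp : p ∈ N.E) {D : Set α} (hD : D ⊆ N.closure {p}) (hpD : p ∉ D)
    (b : α) (k : ℕ) : avoidFull (N.delete D) p b k = avoidFull N p b k := by
  have hco := coindep_of_subset_closure_of_notMem N hp hD hpD
  have hE' := delete_ground_sdiff_closure N hD hpD
  ext W
  simp only [avoidFull, Set.mem_setOf_eq, hE']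
  constructor
  · rintro ⟨h1, h2, h3, h4, h5⟩
    refine ⟨h1, h2, h3, ?_, ?_⟩
    · exact (delete_spanning_iff_of_disjoint N hco (disjoint_of_subset_sdiff_closure N hD h1)).mp h4
    · exact (delete_spanning_iff_of_disjoint N hco
        (disjoint_insert_of_subset_sdiff_closure N hD hpD Set.sdiff_subset)).mp h5
  · rintro ⟨h1, h2, h3, h4, h5⟩
    refine ⟨h1, h2, h3, ?_, ?_⟩
    · exact (delete_spanning_iff_of_disjoint N hco (disjoint_of_subset_sdiff_closure N hD h1)).mpr h4
    · exact (delete_spanning_iff_of_disjoint N hco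
        (disjoint_insert_of_subset_sdiff_closure N hD hpD Set.sdiff_subset)).mpr h5

omit [N.Finite] in
/-- **`g_k` is unchanged by deleting parallel copies of `p`.** -/
lemma throughHat_delete_parallel {p : α} (hp : p ∈ N.E) {D : Set α} (hD : D ⊆ N.closure {p}) (hpD : p ∉ D)
    (b : α) (k : ℕ) : throughHat (N.delete D) p b k = throughHat N p b k := by
  have hco := coindep_of_subset_closure_of_notMem N hp hD hpD
  have hE' := delete_ground_sdiff_closure N hD hpD
  ext W
  simp only [throughHat, Set.mem_setOf_eq, hE']
  constructor
  · rintro ⟨h1, h2, h3, h4, h5⟩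
    refine ⟨h1, h2, h3, ?_, ?_⟩
    · exact (delete_spanning_iff_of_disjoint N hco
        (disjoint_insert_of_subset_sdiff_closure N hD hpD h1)).mp h4
    · exact (delete_spanning_iff_of_disjoint N hco
        (disjoint_insert_of_subset_sdiff_closure N hD hpD Set.sdiff_subset)).mp h5
  · rintro ⟨h1, h2, h3, h4, h5⟩
    refine ⟨h1, h2, h3, ?_, ?_⟩
    · exact (delete_spanning_iff_of_disjoint N hco
        (disjoint_insert_of_subset_sdiff_closure N hD hpD h1)).mpr h4
    · exact (delete_spanning_iff_of_disjoint N hco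
        (disjoint_insert_of_subset_sdiff_closure N hD hpD Set.sdiff_subset)).mpr h5

omit [N.Finite] in
/-- **`ḡ_k` is unchanged by deleting parallel copies of `p`.** -/
lemma avoidHat_delete_parallel {p : α} (hp : p ∈ N.E) {D : Set α} (hD : D ⊆ N.closure {p}) (hpD : p ∉ D)
    (b : α) (k : ℕ) : avoidHat (N.delete D) p b k = avoidHat N p b k := by
  have hco := coindep_of_subset_closure_of_notMem N hp hD hpD
  have hE' := delete_ground_sdiff_closure N hD hpD
  ext W
  simp only [avoidHat, Set.mem_setOf_eq, hE']
  constructor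
  · rintro ⟨h1, h2, h3, h4, h5⟩
    refine ⟨h1, h2, h3, ?_, ?_⟩
    · exact (delete_spanning_iff_of_disjoint N hco
        (disjoint_insert_of_subset_sdiff_closure N hD hpD h1)).mp h4
    · exact (delete_spanning_iff_of_disjoint N hco
        (disjoint_insert_of_subset_sdiff_closure N hD hpD Set.sdiff_subset)).mp h5
  · rintro ⟨h1, h2, h3, h4, h5⟩
    refine ⟨h1, h2, h3, ?_, ?_⟩
    · exact (delete_spanning_iff_of_disjoint N hco
        (disjoint_insert_of_subset_sdiff_closure N hD hpD h1)).mpr h4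
    · exact (delete_spanning_iff_of_disjoint N hco
        (disjoint_insert_of_subset_sdiff_closure N hD hpD Set.sdiff_subset)).mpr h5

omit [N.Finite] in
/-- **The rank is unchanged by deleting a coindependent set.** -/
lemma eRank_delete_of_coindep {D : Set α} (hD : N.Coindep D) : (N.delete D).eRank = N.eRank := by
  rw [Matroid.delete_eq_restrict]
  exact (Matroid.coindep_iff_compl_spanning hD.subset_ground |>.mp hD).eRank_restrict

/-! ## The theorem -/

/-- **(↑) AT LEVEL `4` ALONG A SERIES CLASS OF SIZE `≥ 3`, FROM (↑) AT LEVEL `4` ON THE MATROIDS WITH FEWER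
ELEMENTS** (`M` coloop-free of nullity `4`, `p ∈ E` with `q = #cl✶ {p} ≥ 3`, `b ∉ cl✶ {p}`, `10 ≤ #E`; the
hypothesis `hih` is the inductive hypothesis of the strong induction on `#E`). With `E' = E ∖ cl✶ {p}`: for
`#E' ≤ 7` the claim holds outright (`A_4 = ∅`, resp. `A_4 ≤ ḡ_3` by complementation) and
`upAt_four_of_seriesClass` applies; for `#E' ≥ 8` the class is cut to `{p, p'}`: on `M''' = M ／ (P ∖ {p, p'})`
the inductive hypothesis gives `T_4(N''') ≤ V_5(N''')` (`N''' = M✶ ＼ (P ∖ {p, p'})`), and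
`T_4(N) ≤ A_4 + q g_3 = (A_4 + 2 g_3) + (q − 2) g_3 ≤ T_4(N''') + (q − 2) g_3 ≤ V_5(N''') + (q − 2) g_3
≤ Ā_5 + 2 ḡ_4 + ḡ_3 + (q − 2) g_3 ≤ Ā_5 + q ḡ_4 + ḡ_3 ≤ Ā_5 + q ḡ_4 + C(q,2) ḡ_3 ≤ V_5(N)` with
`g_3 ≤ ḡ_4` (`throughHat_three_le_avoidHat_four`). -/
theorem upAt_four_of_seriesClass_of_ih (M : Matroid α) [M.Finite] (hcol : ∀ e, ¬ M.IsColoop e)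
    (hν : M✶.eRank = 4) {p : α} (hp : p ∈ M.E) (hq : 3 ≤ (M✶.closure {p}).ncard) {b : α} (hb : b ∈ M.E)
    (hbP : b ∉ M✶.closure {p}) (hn : 10 ≤ M.E.ncard)
    (hih : ∀ (M' : Matroid α) [M'.Finite], M'.E.ncard < M.E.ncard → M'✶.eRank ≤ 4 → 10 ≤ M'.E.ncard →
      ∀ b ∈ M'.E, BiIndepUpAt M' b 4) :
    BiIndepUpAt M b 4 := by
  classical
  have hnl := dual_isNonloop_of_coloopFree' M hcol
  have hpE : p ∈ M✶.E := by rwa [Matroid.dual_ground]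
  have hbE : b ∈ M✶.E := by rwa [Matroid.dual_ground]
  set P := M✶.closure {p} with hPdef
  have hPE : P ⊆ M✶.E := M✶.closure_subset_ground _
  have hpP : p ∈ P := M✶.mem_closure_of_mem' rfl hpE
  have hPfin : P.Finite := M✶.ground_finite.subset hPE
  have hE'card : (M✶.E \ P).ncard + P.ncard = M.E.ncard := by
    rw [Set.ncard_sdiff hPE (M.ground_finite.subset hPE), Matroid.dual_ground]
    have := Set.ncard_le_ncard hPE M.ground_finite
    rw [Matroid.dual_ground] at this
    omega
  rcases Nat.lt_or_ge (M✶.E \ P).ncard 8 with h7 | h8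
  · -- `#E' ≤ 7`: the claim itself holds
    have hclaim : UpSeriesClaim M✶ p b := by
      unfold UpSeriesClaim
      rcases Nat.lt_or_ge (M✶.E \ P).ncard 7 with h6 | h7'
      · rw [upFull_four_eq_empty_of_le_six M✶ hν (p := p) (b := b) (by rw [← hPdef]; omega), Set.ncard_empty]
        exact Nat.zero_le _
      · have := upFull_four_le_avoidHat_three_of_seven M✶ hpE hbP (by rw [← hPdef]; omega)
        omega
    exact upAt_four_of_seriesClass M hcol hν hp hq hb hbP hn hclaim
  · -- `#E' ≥ 8`: cut the class to `{p, p'}`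
    obtain ⟨p', hp'⟩ : (P \ {p}).Nonempty := by
      refine Set.nonempty_of_ncard_ne_zero ?_
      rw [Set.ncard_sdiff_singleton_of_mem hpP]
      omega
    have hp'P : p' ∈ P := hp'.1
    have hp'p : p' ≠ p := fun h => hp'.2 (by rw [Set.mem_singleton_iff]; exact h)
    set D := P \ {p, p'} with hDdef
    have hDP : D ⊆ P := Set.sdiff_subset
    have hpD : p ∉ D := fun h => h.2 (Set.mem_insert p {p'})
    have hp'D : p' ∉ D := fun h => h.2 (Set.mem_insert_of_mem p rfl)
    have hDE : D ⊆ M.E := by rw [← Matroid.dual_ground (M := M)]; exact hDP.trans hPE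
    have hpair : ({p, p'} : Set α) ⊆ P := by
      intro x hx
      rcases hx with rfl | hx
      · exact hpP
      · rw [Set.mem_singleton_iff] at hx; rw [hx]; exact hp'P
    have hDfin : D.Finite := hPfin.subset hDP
    have hDcard : D.ncard = P.ncard - 2 := by
      rw [hDdef, Set.ncard_sdiff hpair (Set.toFinite _), Set.ncard_pair hp'p.symm]
    have hbD : b ∉ D := fun h => hbP (hDP h)
    -- the cut-down matroid and its dual
    haveI : (M.contract D).Finite := Matroid.contract_finite
    have hdual : (M.contract D)✶ = M✶.delete D := Matroid.dual_contract M D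
    have hco : M✶.Coindep D := coindep_of_subset_closure_of_notMem M✶ hpE hDP hpD
    have hcard : (M.contract D).E.ncard = M.E.ncard - D.ncard := by
      rw [Matroid.contract_ground, Set.ncard_sdiff hDE hDfin]
    have hcard' : (M.contract D).E.ncard < M.E.ncard := by
      rw [hcard]
      have := Set.ncard_le_ncard hDE M.ground_finite
      omega
    have hν' : (M.contract D)✶.eRank ≤ 4 := by
      rw [hdual, eRank_delete_of_coindep M✶ hco, hν]
    have h10 : 10 ≤ (M.contract D).E.ncard := by rw [hcard]; omega
    have hbM : b ∈ (M.contract D).E := by rw [Matroid.contract_ground]; exact ⟨hb, hbD⟩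
    have hup0 := hih (M.contract D) hcard' hν' h10 b hbM
    unfold BiIndepUpAt at hup0
    rw [biIndep_eq_biSpan_dual, biIndep_eq_biSpan_dual, hdual] at hup0
    have hup : {W ∈ biSpan (M✶.delete D) 4 | b ∈ W}.ncard ≤ {Z ∈ biSpan (M✶.delete D) 5 | b ∉ Z}.ncard := hup0
    -- the families of the cut-down dual are those of `M✶`
    have hcl : (M✶.delete D).closure {p} = {p, p'} := by
      rw [Matroid.delete_closure_eq_of_disjoint M✶ (Set.disjoint_singleton_left.mpr hpD), hDdef,
        Set.sdiff_sdiff_cancel_left hpair]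
    have hnl' : ∀ e ∈ (M✶.delete D).E, (M✶.delete D).IsNonloop e := by
      intro e he
      rw [Matroid.delete_ground] at he
      exact Matroid.delete_isNonloop_iff.mpr ⟨hnl e he.1, he.2⟩
    have hr' : (M✶.delete D).eRank = 4 := by rw [eRank_delete_of_coindep M✶ hco, hν]
    have hp' : p ∈ (M✶.delete D).E := by rw [Matroid.delete_ground]; exact ⟨hpE, hpD⟩
    have hq' : 2 ≤ ((M✶.delete D).closure {p}).ncard := by rw [hcl, Set.ncard_pair hp'p.symm]
    have hbP' : b ∉ (M✶.delete D).closure {p} := by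
      rw [hcl]
      rintro (h | h)
      · exact hbP (h ▸ hpP)
      · rw [Set.mem_singleton_iff] at h; exact hbP (h ▸ hp'P)
    have hge := through_four_ge (M✶.delete D) hnl' hp' hq' hbP'
    have hle := avoid_five_le (M✶.delete D) hnl' hr' hp' hbP'
    rw [hcl, Set.ncard_pair hp'p.symm, upFull_delete_parallel M✶ hpE hDP hpD,
      throughHat_delete_parallel M✶ hpE hDP hpD] at hge
    rw [hcl, Set.ncard_pair hp'p.symm, avoidFull_delete_parallel M✶ hpE hDP hpD,
      avoidHat_delete_parallel M✶ hpE hDP hpD, avoidHat_delete_parallel M✶ hpE hDP hpD] at hle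
    -- the decompositions of `M✶` itself and `g_3 ≤ ḡ_4`
    have hT := through_four_le M✶ hnl hν hpE (by rw [← hPdef]; omega) hbP
    have hV := avoid_five_ge M✶ hnl hpE hq hbP
    rw [← hPdef] at hT hV
    have hg := throughHat_three_le_avoidHat_four M hcol hν hp hb hbP h8
    have hq1 : 1 ≤ P.ncard.choose 2 := by
      have : 1 ≤ (2 : ℕ).choose 2 := by norm_num
      exact this.trans (Nat.choose_le_choose 2 (by omega))
    -- arithmetic
    unfold BiIndepUpAt
    rw [biIndep_eq_biSpan_dual, biIndep_eq_biSpan_dual]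
    obtain ⟨q₂, hq₂⟩ : ∃ q₂, P.ncard = q₂ + 2 := ⟨P.ncard - 2, by omega⟩
    have hsplit : P.ncard * (throughHat M✶ p b 3).ncard =
        2 * (throughHat M✶ p b 3).ncard + q₂ * (throughHat M✶ p b 3).ncard := by
      rw [hq₂, Nat.add_mul, Nat.add_comm]
    have hsplit' : P.ncard * (avoidHat M✶ p b 4).ncard =
        2 * (avoidHat M✶ p b 4).ncard + q₂ * (avoidHat M✶ p b 4).ncard := by
      rw [hq₂, Nat.add_mul, Nat.add_comm]
    have hmul : q₂ * (throughHat M✶ p b 3).ncard ≤ q₂ * (avoidHat M✶ p b 4).ncard := Nat.mul_le_mul_left q₂ hg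
    have hch : (avoidHat M✶ p b 3).ncard ≤ P.ncard.choose 2 * (avoidHat M✶ p b 3).ncard := by
      have := Nat.mul_le_mul_right (avoidHat M✶ p b 3).ncard hq1
      rwa [Nat.one_mul] at this
    simp only [Nat.choose_self, Nat.one_mul] at hle
    calc {W ∈ biSpan M✶ 4 | b ∈ W}.ncard
        ≤ (upFull M✶ p b 4).ncard + P.ncard * (throughHat M✶ p b 3).ncard := hT
      _ = ((upFull M✶ p b 4).ncard + 2 * (throughHat M✶ p b 3).ncard) + q₂ * (throughHat M✶ p b 3).ncard := by
          rw [hsplit]; ring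
      _ ≤ {W ∈ biSpan (M✶.delete D) 4 | b ∈ W}.ncard + q₂ * (throughHat M✶ p b 3).ncard :=
          Nat.add_le_add_right hge _
      _ ≤ {Z ∈ biSpan (M✶.delete D) 5 | b ∉ Z}.ncard + q₂ * (throughHat M✶ p b 3).ncard :=
          Nat.add_le_add_right hup _
      _ ≤ (avoidFull M✶ p b 5).ncard + 2 * (avoidHat M✶ p b 4).ncard + (avoidHat M✶ p b 3).ncard +
            q₂ * (throughHat M✶ p b 3).ncard := Nat.add_le_add_right hle _
      _ ≤ (avoidFull M✶ p b 5).ncard + 2 * (avoidHat M✶ p b 4).ncard + (avoidHat M✶ p b 3).ncard +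
            q₂ * (avoidHat M✶ p b 4).ncard := by omega
      _ ≤ (avoidFull M✶ p b 5).ncard + P.ncard * (avoidHat M✶ p b 4).ncard +
            P.ncard.choose 2 * (avoidHat M✶ p b 3).ncard := by rw [hsplit']; omega
      _ ≤ {Z ∈ biSpan M✶ 5 | b ∉ Z}.ncard := hV

end PercRepro
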